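import Summits.Langlands.Langlands.Theses.PhantomRMYoshida
import Literature.NumberTheory.GaloisRepresentations.ModNCyclotomicCharacter
import Literature.AlgebraicGeometry.Dimension.PointDimension
import HarnessLib

/-!
# Route `PhantomRMYoshida`, crux `ResiduallyYoshidaLifting` (stmt-Langlands-13639): vocabulary of
# the line `yoshida-divisor-selmer-count`

Route-posited objects (D-0016 `<Route>Defs`-type file) shared by the registered stubs of the checked
skeleton `Cruxes/ResiduallyYoshidaLifting/Lines/yoshida-divisor-selmer-count.lean` (lead copy,
registered 2026-08-16 by `ledger skeleton check`) and by the crux file that composes them. NOTHING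
IS ASSERTED: every `def … : Prop` below is a *statement* consumed only as (part of) the type of a
stub theorem or of the crux. Declared in the skeleton's namespace
`Summit.Langlands.Langlands.Cruxes.ResiduallyYoshidaLifting.YoshidaDivisorSelmerCount`, so that a
landed stub `theorem stub_<name> : <registered signature>` reads byte-identically to its
registration.

Objects (the first four are VERBATIM the crux's inline `let εb`, determinant clause, `let Aut`,
`let Sh` — definitionally equal: the skeleton passes the crux's hypotheses to the stubs by `rfl`
unfolding):

* `εb p` — the mod-`p` cyclotomic character `ε̄ : Γ_ℚ → (ℤ/p)ˣ` through Mathlib's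
  `modularCyclotomicCharacter` on `Γ_ℚ` (= Literature `modNCyclotomicCharacter ℚ p`, `rfl`);
* `DetC p k σ σ'` — `det σ̄ = det σ̄' = ε̄⁻¹`;
* `Aut p hcpt ι r` — the automorphy clause: an L-algebraic cuspidal `π` on `GL₄(𝔸_ℚ)`
  (`CuspidalAutomorphicRepData 4 ℚ hcpt`, `IsLAlgebraic`) whose Satake parameters give the
  arithmetic-Frobenius polynomials of `r` a.e. (`HasSatakeParamAt`, `arithFrobPolyOfSatake ι q_v 1`);
* `Sh p k red σ σ' r` — the shape clause: symplectic with similitude `ε⁻¹`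
  (`IsSymplecticWithMultiplierFun`), Greenberg-ordinary of Hodge–Tate shape `(0,0,1,1)` and
  residually distinguished at `p` (`IsGreenbergOrdinaryOfShapeAt`, `IsResiduallyDistinguishedAt`),
  residually `σ̄ ⊕ σ̄'` through `red` on a.e. Frobenius polynomial;
* `IsOrdinaryClassicalLimit p hcpt ι r` — `r` is a `p`-adic limit, on integral Frobenius
  polynomials outside one finite set of places, of AUTOMORPHIC symplectic Greenberg-ordinary
  representations of regular shape in the (2,2)-chamber (shape positionally `≡ (0,0,1,1)` modulo
  `(p-1)p^n` at depth `n`) — the hypothesis of the line's classicality stub and the conclusion its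
  family stub delivers;
* `IsConnectedInDimTwo R` — `Spec R` is connected in dimension 2 (the minimal primes admit no
  partition into two non-empty classes all of whose cross-meetings `V(𝔮₁ + 𝔮₂)` have dimension
  `< 2`), the hypothesis of the line's pure-algebra propagation stub.

Proved here (so that this vocabulary lands through a registered stub, D-0027 §3.2 c): the line's
pure-algebra propagation stub `stub_stableComponentsModular` (registered signature, verbatim) —
modularity (`K ≤ 𝔮`) propagates from a Yoshida minimal prime to every minimal prime of a Noetherian
ring through connectedness in dimension 2, generic stable–stable propagation and the height-one
input — with its one lemma `exists_prime_ringKrullDim_quotient_eq_two` (a prime maximal among those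
above `J` of coheight `≥ 2` has coheight exactly `2`). Proof taken over from the standing disprover's
`Cruxes/ResiduallyYoshidaLifting/Disproof.lean` (T3, refuter-cdisprove-stmt-Langlands-13639), checked
here against the registered statement.

Not here (deliberately): the two `Type`-valued interfaces `LocalCriterionDatum`,
`YoshidaFamilyDatum` of the family stub (appended when that stub is worked in-tree), and the four
stub statements themselves (they are the types of the stub theorems, stated in full where proved).

References: BoxerEtAl2021 §2, §7.3 (conventions: multiplier `ε⁻¹`, Hodge–Tate shape `(0,0,1,1)`,
`p`-distinguished); BuzzardGeeLMS2014 Conj. 3.2.1 (L-algebraic normalisation); SGA2 XIII.2.1 /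
Hartshorne 1962 (connectedness in dimension `d`).
-/

noncomputable section

-- `Summit.Langlands.Langlands.…` (summit = sub-problem name, D-0017 layout) trips `dupNamespace` on every decl.
set_option linter.dupNamespace false
set_option autoImplicit false

open IsDedekindDomain Filter
open Literature.NumberTheory.GaloisRepresentations Literature.NumberTheory.Automorphic

namespace Summit.Langlands.Langlands.Cruxes.ResiduallyYoshidaLifting.YoshidaDivisorSelmerCount

/-- The route's inline mod-`p` cyclotomic character `ε̄ : Γ_ℚ → (ℤ/p)ˣ` (verbatim `let εb` of the crux;
Mathlib `modularCyclotomicCharacter` on `Γ_ℚ`). [folklore] -/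
def εb (p : ℕ) [Fact p.Prime] : Field.absoluteGaloisGroup ℚ →* (ZMod p)ˣ :=
  (modularCyclotomicCharacter (AlgebraicClosure ℚ)
    (HasEnoughRootsOfUnity.natCard_rootsOfUnity (AlgebraicClosure ℚ) p)).comp
    (MulSemiringAction.toRingAut (Field.absoluteGaloisGroup ℚ) (AlgebraicClosure ℚ))

/-- `det σ̄ = det σ̄' = ε̄⁻¹` (verbatim determinant clause of the crux). [folklore] -/
def DetC (p : ℕ) [Fact p.Prime] (k : Type) [Field k] [CharP k p] [TopologicalSpace k]
    [DiscreteTopology k] (σ σ' : FramedGaloisRep ℚ k 2) : Prop :=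
  ∀ g, FramedRep.det σ g = (Units.map (ZMod.castHom (dvd_refl p) k).toMonoidHom (εb p g))⁻¹ ∧
    FramedRep.det σ' g = FramedRep.det σ g

/-- `Aut r` — the automorphy clause of the crux, verbatim (`let Aut` there): an L-algebraic cuspidal
`π` on `GL₄(𝔸_ℚ)` whose Satake parameters match the arithmetic-Frobenius polynomials of `r` a.e.
[cite: BuzzardGeeLMS2014, Conj. 3.2.1 (normalisation)] -/
def Aut (p : ℕ) [Fact p.Prime] (hcpt : isCompact_glFiniteIntegralLevel 4 ℚ) (ι : PadicAlgCl p ≃+* ℂ)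
    (r : FramedGaloisRep ℚ (PadicAlgCl p) 4) : Prop :=
  ∃ π : CuspidalAutomorphicRepData 4 ℚ hcpt, π.1.IsLAlgebraic ∧
    ∀ᶠ v : HeightOneSpectrum (NumberField.RingOfIntegers ℚ) in Filter.cofinite, ∃ a : Multiset ℂ,
      π.1.HasSatakeParamAt v a ∧ r.IsUnramifiedAt v ∧
        r.HasFrobCharpolyAt v (arithFrobPolyOfSatake ι v.residueCard 1 a)

/-- `Sh r` — the shape clause of the crux, verbatim (`let Sh` there): symplectic with similitude
`ε⁻¹`, Greenberg-ordinary of Hodge–Tate shape `(0,0,1,1)` and residually distinguished at `p`, and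
residually of Yoshida type `σ̄ ⊕ σ̄'` through `red` (a.e. Frobenius polynomial `≡ charpoly σ̄ · charpoly σ̄'`).
[cite: BoxerEtAl2021, §2 and §7.3 (conventions)] -/
def Sh (p : ℕ) [Fact p.Prime] (k : Type) [Field k] [TopologicalSpace k]
    (red : Valued.integer (PadicAlgCl p) →+* k) (σ σ' : FramedGaloisRep ℚ k 2)
    (r : FramedGaloisRep ℚ (PadicAlgCl p) 4) : Prop :=
  (r.IsSymplecticWithMultiplierFun (fun g => algebraMap ℚ_[p] (PadicAlgCl p)
      ((((GaloisRep.cyclotomicCharacter ℚ p g)⁻¹ : ℤ_[p]ˣ) : ℤ_[p]) : ℚ_[p]))) ∧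
    (∀ v : HeightOneSpectrum (NumberField.RingOfIntegers ℚ),
      ((p : ℕ) : NumberField.RingOfIntegers ℚ) ∈ v.asIdeal →
        r.IsGreenbergOrdinaryOfShapeAt v ![0, 0, 1, 1] ∧ r.IsResiduallyDistinguishedAt v ![0, 0, 1, 1]) ∧
    (∀ᶠ v : HeightOneSpectrum (NumberField.RingOfIntegers ℚ) in Filter.cofinite,
      r.IsUnramifiedAt v ∧ σ.IsUnramifiedAt v ∧ σ'.IsUnramifiedAt v ∧
        ∃ (P : Polynomial (Valued.integer (PadicAlgCl p))) (P₁ P₂ : Polynomial k),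
          r.HasFrobCharpolyAt v (P.map (Valued.integer (PadicAlgCl p)).subtype) ∧
            σ.HasFrobCharpolyAt v P₁ ∧ σ'.HasFrobCharpolyAt v P₂ ∧ P.map red = P₁ * P₂)

/-! ## Objects posited by the line -/

/-- `r` is an ORDINARY CLASSICAL LIMIT: outside one finite set `S` of places, for every `n`, the
Frobenius polynomials of `r` are congruent modulo `p^n` (coefficientwise, in `𝒪_{ℚ̄_p}`) to those of
an AUTOMORPHIC `r'` (clause `Aut`) which is symplectic (some similitude), Greenberg-ordinary of some
REGULAR inertial shape `a` (strictly increasing Hodge–Tate numbers) lying in the (2,2)-CHAMBER — `a` is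
POSITIONALLY congruent to `(0,0,1,1)` modulo `(p-1)·p^n` (lead reshape 2026-08-16 after Disproof T4(b):
multiset congruence alone also admits the (1,3)-chamber `(0,1,N,N+1)`, where no weight-(2,2)
classicality engine applies) — and residually distinguished at `p` (vacuous for `StrictMono a`,
Disproof T4(c); kept verbatim).
Intended instances: the Galois representations of the classical cuspidal points of regular weight
`(k₁,k₂) → (2,2)` `p`-adically on the stable ordinary (Hida) component through `x_r`.
[cite: BoxerEtAl2021, §7.3 (p-adic weights of the ordinary family)] -/
def IsOrdinaryClassicalLimit (p : ℕ) [Fact p.Prime] (hcpt : isCompact_glFiniteIntegralLevel 4 ℚ)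
    (ι : PadicAlgCl p ≃+* ℂ) (r : FramedGaloisRep ℚ (PadicAlgCl p) 4) : Prop :=
  ∃ S : Set (HeightOneSpectrum (NumberField.RingOfIntegers ℚ)), S.Finite ∧
    ∀ n : ℕ, ∃ (r' : FramedGaloisRep ℚ (PadicAlgCl p) 4) (a : Fin 4 → ℕ),
      Aut p hcpt ι r' ∧ StrictMono a ∧
      (a 0 = 0 ∧ (a 1 : ZMod ((p - 1) * p ^ n)) = 0 ∧ (a 2 : ZMod ((p - 1) * p ^ n)) = 1 ∧
        (a 3 : ZMod ((p - 1) * p ^ n)) = 1) ∧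
      (∃ ν : Field.absoluteGaloisGroup ℚ → PadicAlgCl p, r'.IsSymplecticWithMultiplierFun ν) ∧
      (∀ v : HeightOneSpectrum (NumberField.RingOfIntegers ℚ),
        ((p : ℕ) : NumberField.RingOfIntegers ℚ) ∈ v.asIdeal →
          r'.IsGreenbergOrdinaryOfShapeAt v a ∧ r'.IsResiduallyDistinguishedAt v a) ∧
      ∀ v ∉ S, r.IsUnramifiedAt v ∧ r'.IsUnramifiedAt v ∧
        ∃ P P' : Polynomial (Valued.integer (PadicAlgCl p)),
          r.HasFrobCharpolyAt v (P.map (Valued.integer (PadicAlgCl p)).subtype) ∧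
          r'.HasFrobCharpolyAt v (P'.map (Valued.integer (PadicAlgCl p)).subtype) ∧
          ∀ i : ℕ, ‖((P.coeff i : Valued.integer (PadicAlgCl p)) : PadicAlgCl p) -
              ((P'.coeff i : Valued.integer (PadicAlgCl p)) : PadicAlgCl p)‖ ≤ ‖(p : PadicAlgCl p)‖ ^ n

/-- `Spec R` is CONNECTED IN DIMENSION 2: the minimal primes of `R` cannot be split into two
non-empty classes all of whose cross-intersections `V(𝔮₁) ∩ V(𝔮₂) = V(𝔮₁ + 𝔮₂)` have dimension `< 2`
(Hartshorne's "connected in dimension `d`", SGA2 XIII.2.1). [folklore] -/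
def IsConnectedInDimTwo (R : Type) [CommRing R] : Prop :=
  ∀ 𝒜 : Set (Ideal R), 𝒜 ⊆ minimalPrimes R → 𝒜.Nonempty → (minimalPrimes R \ 𝒜).Nonempty →
    ∃ 𝔮₁ ∈ 𝒜, ∃ 𝔮₂ ∈ minimalPrimes R \ 𝒜, (2 : WithBot ℕ∞) ≤ ringKrullDim (R ⧸ (𝔮₁ ⊔ 𝔮₂))

/-- The two mod-`p` cyclotomic characters agree: the route's inline `εb p` is definitionally the
Literature character `modNCyclotomicCharacter ℚ p` (so every Literature lemma about the latter
applies to the crux's determinant clause). -/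
theorem εb_eq_modNCyclotomicCharacter (p : ℕ) [Fact p.Prime] :
    εb p = modNCyclotomicCharacter ℚ p := rfl

/-! ## The propagation stub (pure commutative algebra) -/

open Order in
/-- In a Noetherian ring, if `dim R/J ≥ 2` then some prime `P ⊇ J` has `dim R/P = 2` EXACTLY:
take `P` maximal among the primes above `J` of coheight `≥ 2` (Noetherian induction on ideals);
maximality forces coheight exactly `2` (`Order.coheight_eq_coe_iff_maximal_le_coheight`). No
finiteness of `dim R` is used. (Proof: Disproof.lean T3, refuter-cdisprove-stmt-Langlands-13639.) -/
theorem exists_prime_ringKrullDim_quotient_eq_two {R : Type} [CommRing R] [IsNoetherianRing R]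
    (J : Ideal R) (hJ : (2 : WithBot ℕ∞) ≤ ringKrullDim (R ⧸ J)) :
    ∃ P : Ideal R, P.IsPrime ∧ J ≤ P ∧ ringKrullDim (R ⧸ P) = 2 := by
  classical
  rw [ringKrullDim_quotient] at hJ
  have hJ' : ((2 : ℕ) : WithBot ℕ∞) ≤ Order.krullDim (PrimeSpectrum.zeroLocus (R := R) J) := by
    exact_mod_cast hJ
  obtain ⟨l, hl⟩ := Order.le_krullDim_iff.mp hJ'
  let l' : LTSeries (PrimeSpectrum R) := l.map Subtype.val (fun _ _ h => h)
  have hhead : J ≤ (l.head).val.asIdeal := by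
    have hmem := (l.head).property
    rw [PrimeSpectrum.mem_zeroLocus] at hmem
    intro x hx
    exact hmem hx
  have hcoht₀ : (2 : ℕ∞) ≤ coheight (l.head).val := by
    have h := Order.length_le_coheight_head (p := l')
    have hlen : l'.length = 2 := by simp [l', hl]
    have hh : l'.head = (l.head).val := by simp [l']
    rw [hlen, hh] at h
    exact_mod_cast h
  let S : Set (Ideal R) :=
    {I | ∃ y : PrimeSpectrum R, y.asIdeal = I ∧ J ≤ I ∧ (2 : ℕ∞) ≤ coheight y}
  have hSne : S.Nonempty := ⟨_, (l.head).val, rfl, hhead, hcoht₀⟩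
  obtain ⟨M, ⟨P, rfl, hJP, hP2⟩, hmax⟩ :=
    set_has_maximal_iff_noetherian.mpr (inferInstance : IsNoetherian R R) S hSne
  refine ⟨P.asIdeal, P.isPrime, hJP, ?_⟩
  have hcoht : coheight P = (2 : ℕ) := by
    rw [Order.coheight_eq_coe_iff_maximal_le_coheight]
    refine ⟨by exact_mod_cast hP2, fun y hy hPy => ?_⟩
    have hyS : y.asIdeal ∈ S :=
      ⟨y, rfl, hJP.trans ((PrimeSpectrum.asIdeal_le_asIdeal _ _).mpr hPy), by exact_mod_cast hy⟩
    have hnot := hmax y.asIdeal hyS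
    by_contra hyP
    refine hnot (lt_of_le_of_ne ((PrimeSpectrum.asIdeal_le_asIdeal _ _).mpr hPy) fun h => hyP ?_)
    exact le_of_eq (PrimeSpectrum.ext h.symm)
  rw [← Literature.AlgebraicGeometry.Dimension.PrimeSpectrum.coe_coheight_eq_ringKrullDim_quotient P,
    hcoht]
  rfl

/-- **STUB 3 of the line (`stub_stableComponentsModular`, registered signature verbatim) —
modularity propagates through the component graph.** `R` Noetherian local; ideals `K ≤ I`
("modular" ≤ "reducible"). Assume: a minimal prime contains `I`; `Spec R` is connected in
dimension 2; `K ≤ ·` passes between minimal primes NOT containing `I` that meet in dimension `≥ 2`;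
every minimal prime inside a prime `P ⊇ I` with `dim R/P = 2` is modular. Then every minimal prime
of `R` is modular. Proof: `𝒜 := {𝔮 minimal | K ≤ 𝔮}` contains the Yoshida minimal prime; if some
minimal `𝔮 ∉ 𝒜`, connectedness gives `𝔮₁ ∈ 𝒜`, `𝔮₂ ∉ 𝒜` meeting in dimension `≥ 2`; `I ⊄ 𝔮₂`
(as `K ≤ I`); if `I ⊄ 𝔮₁` generic propagation puts `𝔮₂ ∈ 𝒜`, else a prime `P ⊇ 𝔮₁ ⊔ 𝔮₂ ⊇ I`
with `dim R/P = 2` exactly (`exists_prime_ringKrullDim_quotient_eq_two`) does, by the height-one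
input — contradiction. `IsLocalRing R` is unused (kept: registered signature). (Proof: Disproof.lean
T3 `stableComponentsModular_holds`, refuter-cdisprove-stmt-Langlands-13639.) -/
theorem stub_stableComponentsModular :
    ∀ (R : Type) [CommRing R] [IsNoetherianRing R] [IsLocalRing R] (I K : Ideal R), K ≤ I →
      (∃ 𝔮 ∈ minimalPrimes R, I ≤ 𝔮) → IsConnectedInDimTwo R →
      (∀ 𝔮₁ ∈ minimalPrimes R, ∀ 𝔮₂ ∈ minimalPrimes R, ¬ I ≤ 𝔮₁ → ¬ I ≤ 𝔮₂ →
        (2 : WithBot ℕ∞) ≤ ringKrullDim (R ⧸ (𝔮₁ ⊔ 𝔮₂)) → K ≤ 𝔮₁ → K ≤ 𝔮₂) →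
      (∀ P : Ideal R, P.IsPrime → I ≤ P → ringKrullDim (R ⧸ P) = 2 →
        ∀ 𝔮 ∈ minimalPrimes R, 𝔮 ≤ P → K ≤ 𝔮) →
      ∀ 𝔮 ∈ minimalPrimes R, K ≤ 𝔮 := by
  intro R _ _ _ I K hKI hyos hconn hgen hht 𝔮 h𝔮
  obtain ⟨𝔮₀, h𝔮₀, hI𝔮₀⟩ := hyos
  by_contra hK𝔮
  let 𝒜 : Set (Ideal R) := {q | q ∈ minimalPrimes R ∧ K ≤ q}
  have h𝒜sub : 𝒜 ⊆ minimalPrimes R := fun q hq => hq.1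
  have h𝒜ne : 𝒜.Nonempty := ⟨𝔮₀, h𝔮₀, hKI.trans hI𝔮₀⟩
  have h𝒜c : (minimalPrimes R \ 𝒜).Nonempty := ⟨𝔮, h𝔮, fun h => hK𝔮 h.2⟩
  obtain ⟨𝔮₁, h𝔮₁, 𝔮₂, h𝔮₂, hdim⟩ := hconn 𝒜 h𝒜sub h𝒜ne h𝒜c
  have h𝔮₂min : 𝔮₂ ∈ minimalPrimes R := h𝔮₂.1
  have hK𝔮₂ : ¬ K ≤ 𝔮₂ := fun h => h𝔮₂.2 ⟨h𝔮₂min, h⟩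
  have hI𝔮₂ : ¬ I ≤ 𝔮₂ := fun h => hK𝔮₂ (hKI.trans h)
  by_cases hI𝔮₁ : I ≤ 𝔮₁
  · obtain ⟨P, hP, hle, hdimP⟩ := exists_prime_ringKrullDim_quotient_eq_two (𝔮₁ ⊔ 𝔮₂) hdim
    exact hK𝔮₂ (hht P hP (hI𝔮₁.trans (le_sup_left.trans hle)) hdimP 𝔮₂ h𝔮₂min
      (le_sup_right.trans hle))
  · exact hK𝔮₂ (hgen 𝔮₁ h𝔮₁.1 𝔮₂ h𝔮₂min hI𝔮₁ hI𝔮₂ hdim h𝔮₁.2)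

end Summit.Langlands.Langlands.Cruxes.ResiduallyYoshidaLifting.YoshidaDivisorSelmerCount

end
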